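import Mathlib
import HarnessLib
import Summits.HubbardSuperconductivity.HubbardSuperconductivity.Theorems.KLProgrammeKLRegimeVolumeLimitTwoPointHamiltonianBound
import Summits.HubbardSuperconductivity.HubbardSuperconductivity.Theorems.KLProgrammeKLRegimeVolumeLimitTwoTimeAnchor
import Literature.MathematicalPhysics.QuantumLattice.FermionQuasiFreeDynamics
import Summits.HubbardSuperconductivity.HubbardSuperconductivity.Theorems.KLProgrammeThermalGreenMatsubaraTimeAllU

/-!
# Convention anchor for (H1): at zero coupling the consumer's (H1) value IS the Grassmann limit entry `vertexLimitEntry … (0 − s)`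
# (seat hubbard-kl-k3c5-p2, g3, «analytic-continuation-free assembly via FinalTwoLegVolLimit»)

Route `KLProgramme`, child VOLUME-LIMIT (stmt-HubbardSuperconductivity-19921 / 19858), stub `stub_vl_bound`.  `hamiltonianBound_of_H1`,
`stub_vl_bound[_V14]_of_H1/_of_hasSumH1` consume (H1) with the value
`e^{−βUL²/4}·Tr(e^{−(β−s)H'} c†_{x↑} e^{−sH'} c_{y↑})/Z_{H₀}`, `H' = hubbardTorusWith 2 L 1 U (μ + U/2)`.  The sign / site / time conventions of that
value are pinned here against the tree's limit object at `U = 0`: the value reduces to the evolved free thermal correlator `⟨c†_{x↑}(s) c_{y↑}⟩₀`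
(`trace_gibbsWeight_twoTime_div` + `thermalCorr_dGamma_evolve_creation_annihilation`), which is k3c5-p1's entry-level anchor
`vertexLimitEntry_neg_eq_fermiMatrix_entry` (p486165) — the `n = 0` term of the Grassmann limit series of `∫dμ_{C_M}ψ⁺_{(x,s)↑}ψ⁻_{(y,0)↑}`:

* `H1value_zero_coupling_eq_thermalCorr` — at `U = 0` the (H1) value is `⟨e^{sH₀}c†_x e^{−sH₀} · c_y⟩_{β,H₀}`;
* **`H1value_zero_coupling_eq_vertexLimitEntry`** — `= vertexLimitEntry L β μ x y 0 0 (0 − s)` for `s > 0`, `L ≥ 3`.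

So the consumer's (H1) form is the right one at zero coupling (same orientation as the anchor of the (H1) suppliers).  Everything is proved.
-/

noncomputable section

namespace Summit.HubbardSuperconductivity.HubbardSuperconductivity.Theorems.TwoPointAssembly

set_option linter.dupNamespace false -- summit = problem name (single-conjunct summit), D-0017

open Finset Filter Topology Complex NormedSpace MeasureTheory Literature.MathematicalPhysics.QuantumLattice Literature.Probability.LatticeModels
  GrassmannAlgebra
open Summit.HubbardSuperconductivity.HubbardSuperconductivity.Theorems.MatsubaraAllU
open scoped ComplexOrder Matrix.Norms.L2Operator Nat

variable {L : ℕ} [NeZero L]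

omit [NeZero L] in
/-- At `U = 0` the torus Hamiltonian of the (H1) value is the free second-quantised one-body operator `dΓ(h)`, `h = hubbardOneBody … 1 μ`. -/
theorem hubbardTorusWith_zero_coupling_eq_dGamma (μ : ℝ) :
    hubbardTorusWith 2 L 1 0 (μ + 0 / 2) = dGamma (hubbardOneBody (fermionTorusGraph 2 L) 1 μ) := by
  rw [zero_div, add_zero, ← hamiltonianWith_zero_eq_dGamma]
  rfl

/-- **At zero coupling the (H1) value is the evolved free thermal correlator** `⟨e^{sH₀}c†_{x↑}e^{−sH₀} · c_{y↑}⟩_{β,H₀}`. -/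
theorem H1value_zero_coupling_eq_thermalCorr (β μ s : ℝ) (x y : TorusSite 2 L) :
    (Real.exp (-(β * 0 / 4 * (L : ℝ) ^ 2)) : ℂ) *
        (Matrix.gibbsWeight (β - s) (hubbardTorusWith 2 L 1 0 (μ + 0 / 2)) * creation (orb (FermionTorus.ofTorusSite x) 0) *
          (Matrix.gibbsWeight s (hubbardTorusWith 2 L 1 0 (μ + 0 / 2)) * annihilation (orb (FermionTorus.ofTorusSite y) 0))).trace /
        Matrix.partitionFn β (hubbardTorusWith 2 L 1 0 μ) =
      Matrix.thermalCorr β (dGamma (hubbardOneBody (fermionTorusGraph 2 L) 1 μ))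
        (exp (((s : ℝ) : ℂ) • dGamma (hubbardOneBody (fermionTorusGraph 2 L) 1 μ)) * creation (orb (FermionTorus.ofTorusSite x) 0) *
          exp (-(((s : ℝ) : ℂ) • dGamma (hubbardOneBody (fermionTorusGraph 2 L) 1 μ))))
        (exp ((0 : ℂ) • dGamma (hubbardOneBody (fermionTorusGraph 2 L) 1 μ)) * annihilation (orb (FermionTorus.ofTorusSite y) 0) *
          exp (-((0 : ℂ) • dGamma (hubbardOneBody (fermionTorusGraph 2 L) 1 μ)))) := by
  have h0 : hubbardTorusWith 2 L 1 0 μ = dGamma (hubbardOneBody (fermionTorusGraph 2 L) 1 μ) := by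
    rw [← hamiltonianWith_zero_eq_dGamma]; rfl
  rw [hubbardTorusWith_zero_coupling_eq_dGamma, h0, show β * 0 / 4 * (L : ℝ) ^ 2 = 0 by ring, neg_zero, Real.exp_zero, Complex.ofReal_one,
    one_mul, trace_gibbsWeight_twoTime_div, Matrix.thermalCorr, Matrix.imagTimeEvolve_eq]
  simp only [zero_smul, neg_zero, NormedSpace.exp_zero, Matrix.one_mul, Matrix.mul_one]

/-- **CONVENTION ANCHOR: at zero coupling the consumer's (H1) value IS the Grassmann limit entry** `vertexLimitEntry L β μ x y ↑ ↑ (0 − s)` (`s > 0`,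
`L ≥ 3`) — the `n = 0` term of the limit series of `∫dμ_{C_M}ψ⁺_{(x,s)↑}ψ⁻_{(y,0)↑}e^{−V}` (k3c5-p1's anchor p486165 on the supplier side). -/
theorem H1value_zero_coupling_eq_vertexLimitEntry (hL : 3 ≤ L) (β μ : ℝ) (x y : TorusSite 2 L) {s : ℝ} (hs : 0 < s) :
    (Real.exp (-(β * 0 / 4 * (L : ℝ) ^ 2)) : ℂ) *
        (Matrix.gibbsWeight (β - s) (hubbardTorusWith 2 L 1 0 (μ + 0 / 2)) * creation (orb (FermionTorus.ofTorusSite x) 0) *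
          (Matrix.gibbsWeight s (hubbardTorusWith 2 L 1 0 (μ + 0 / 2)) * annihilation (orb (FermionTorus.ofTorusSite y) 0))).trace /
        Matrix.partitionFn β (hubbardTorusWith 2 L 1 0 μ) =
      vertexLimitEntry L β μ x y 0 0 (0 - s) := by
  rw [H1value_zero_coupling_eq_thermalCorr, vertexLimitEntry_neg_eq_fermiMatrix_entry hL β μ 0 0 x y hs]
  -- (the `Orb (FermionTorus 2 L)` order instances of the torus-side and the `ι`-generic statements differ syntactically: `convert`)
  convert thermalCorr_dGamma_evolve_creation_annihilation (isHermitian_hubbardOneBody (fermionTorusGraph 2 L) 1 μ) β 0 ((s : ℝ) : ℂ)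
    (orb (FermionTorus.ofTorusSite x) 0) (orb (FermionTorus.ofTorusSite y) 0) using 12

/-- **(H1) HOLDS AT ZERO COUPLING, in the consumer's form** (`L ≥ 3`, `β > 0`, `s ∈ (0,β)`): the free position two-point word converges to the
consumer's (H1) value at `U = 0` — k3c5-p2's all-`U` time-resolved limit (p470680) at `U = 0` has only its `n = 0` term, which is the anchor entry.
A kernel-checked consistency test of the hypothesis of `hamiltonianBound_of_H1` / `stub_vl_bound[_V14]_of_H1`. -/
theorem H1_zero_coupling (hL : 3 ≤ L) {β : ℝ} (hβ : 0 < β) (μ : ℝ) (x y : TorusSite 2 L) {s : ℝ} (hs : s ∈ Set.Ioo (0 : ℝ) β) :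
    Tendsto (fun M : ℕ => gaussExpect ℂ (hubbardCovariance L M β μ 0)
        (positionField L M β 0 0 x s * positionField L M β 1 0 y 0 * grassmannExp (-(hubbardInteraction L M β 0)))) atTop
      (𝓝 ((Real.exp (-(β * 0 / 4 * (L : ℝ) ^ 2)) : ℂ) *
        (Matrix.gibbsWeight (β - s) (hubbardTorusWith 2 L 1 0 (μ + 0 / 2)) * creation (orb (FermionTorus.ofTorusSite x) 0) *
          (Matrix.gibbsWeight s (hubbardTorusWith 2 L 1 0 (μ + 0 / 2)) * annihilation (orb (FermionTorus.ofTorusSite y) 0))).trace /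
        Matrix.partitionFn β (hubbardTorusWith 2 L 1 0 μ))) := by
  rw [H1value_zero_coupling_eq_vertexLimitEntry hL β μ x y hs.1]
  have h := tendsto_gaussExpect_twoPoint_mul_grassmannExp_allU_time (L := L) hβ μ 0 0 0 x y ⟨hs.1.le, hs.2⟩ (Set.left_mem_Ico.2 hβ)
  -- the `n = 0` term is the entry, all other terms carry `0ⁿ = 0`
  have hconst : ∀ (xv : Fin 0 → TorusSite 2 L) (τ : Fin 0 → ℝ),
      (Matrix.of fun i j : Fin (0 * 2 + 1) =>
        vertexLimitEntry L β μ ((Fin.append xv ![x, y] : Fin (0 + 2) → TorusSite 2 L) (twoPointPlusEnum 0 0 i).1)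
          ((Fin.append xv ![x, y] : Fin (0 + 2) → TorusSite 2 L) (twoPointMinusEnum 0 0 j).1)
          (twoPointPlusEnum 0 0 i).2 (twoPointMinusEnum 0 0 j).2
          ((Fin.append τ ![s, 0] : Fin (0 + 2) → ℝ) (twoPointMinusEnum 0 0 j).1 -
            (Fin.append τ ![s, 0] : Fin (0 + 2) → ℝ) (twoPointPlusEnum 0 0 i).1)).det =
      vertexLimitEntry L β μ x y 0 0 (0 - s) := by
    intro xv τ
    rw [Matrix.det_fin_one]
    simp only [Matrix.of_apply, twoPointPlusEnum_zero, twoPointMinusEnum_zero, Fin.append_right, Matrix.cons_val_zero,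
      Matrix.cons_val_one]
  have hsum : (∑' n : ℕ, ((-1 : ℂ) ^ n * ((n ! : ℂ))⁻¹) * ((((0 : ℝ) : ℂ)) ^ n * ∑ xv : Fin n → TorusSite 2 L,
      ∫ τ in Set.Icc (0 : Fin n → ℝ) (fun _ => β),
        (Matrix.of fun i j : Fin (n * 2 + 1) =>
          vertexLimitEntry L β μ ((Fin.append xv ![x, y] : Fin (n + 2) → TorusSite 2 L) (twoPointPlusEnum n 0 i).1)
            ((Fin.append xv ![x, y] : Fin (n + 2) → TorusSite 2 L) (twoPointMinusEnum n 0 j).1)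
            (twoPointPlusEnum n 0 i).2 (twoPointMinusEnum n 0 j).2
            ((Fin.append τ ![s, 0] : Fin (n + 2) → ℝ) (twoPointMinusEnum n 0 j).1 -
              (Fin.append τ ![s, 0] : Fin (n + 2) → ℝ) (twoPointPlusEnum n 0 i).1)).det)) =
      vertexLimitEntry L β μ x y 0 0 (0 - s) := by
    rw [tsum_eq_single 0]
    · simp_rw [hconst]
      rw [Fintype.sum_unique, MeasureTheory.setIntegral_const, measureReal_def,
        Real.volume_Icc_pi_toReal (a := (0 : Fin 0 → ℝ)) (b := fun _ => β) (fun _ => hβ.le)]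
      simp
    · intro n hn
      rw [Complex.ofReal_zero, zero_pow hn, zero_mul, mul_zero]
  rw [hsum] at h
  exact h

end Summit.HubbardSuperconductivity.HubbardSuperconductivity.Theorems.TwoPointAssembly

end
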